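import Summits.HodgeConjecture.HodgeConjecture.Theorems.NikulinTwinTransportAssemblyConiveauFree
import Literature.AlgebraicGeometry.HodgeTheory.ComplexConjugationHolds
import Literature.NumberTheory.Transcendental.DeRhamTheoremMultiplicative
import Literature.AlgebraicGeometry.Surfaces.K3HodgeTypesHolds
import Literature.AlgebraicGeometry.Surfaces.K3LatticeInvariants

/-!
# Route NikulinTwinTransport · frame item `Assembly` (stmt-HodgeConjecture-13942) —
# the frame modulo the TWO remaining named facts

The frame item
`Assembly := TwinSimilitudeAlgebraic → HodgeIsometryAlgebraic → TwinExists → LefschetzOneOneK3 →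
SectorComplement → HodgeConjecture` is, by `assembly_iff_glue`, exactly "X + Buskin + the universal
twin + Lefschetz `(1,1)` give the sector `SquareHodgeOfSqrtTwo`". Seat 13942-0 proved it
(`assembly_of_facts'`, file `…AssemblyConiveauFree`) modulo four named facts: de Rham's theorem in
multiplicative form, Hodge models of smooth projective varieties, markings of K3 surfaces, and
`b₁(K3) = b₃(K3) = 0`. The first two are now THEOREMS of the tree
(`Literature.NumberTheory.Transcendental.exists_deRhamIsoFamily_holds`,
`Literature.AlgebraicGeometry.HodgeTheory.nonempty_hodgeModel_holds`), so the frame — and the glue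
`SquareGlue` it factors through — rest on exactly

* `Literature.AlgebraicGeometry.Surfaces.Huybrechts_K3_marking_exists` (Huybrechts, *Lectures on K3
  Surfaces*, Ch. 1 Prop. 3.5: `H²(S, ℤ) ≅ Λ_{K3}` with the cup form; in the tree reduced to
  `b₂ = 22`, evenness of the intersection form and the signature/positivity package,
  `Huybrechts_K3_marking_exists_holds_of`), and
* `Literature.AlgebraicGeometry.Surfaces.Huybrechts_K3_oddBetti_vanish` (ibid. Ch. 1 §3.2–3.3:
  `H¹(S(ℂ); ℂ) = H³(S(ℂ); ℂ) = 0`; in the tree reduced to the GAGA comparison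
  `H¹(S, 𝒪_S) = 0 ⟹ H^{0,1}_{∂̄}(S^an) = 0`, `K3BettiNumbersProofs`).

Results: `squareGlue_of_marking_of_oddBetti` (the glue decl `SquareGlue`) and
`assembly_of_marking_of_oddBetti` (the frame decl `Assembly`) from these two facts and nothing
else; `assembly_of_oddBetti_of_k3Invariants` — the same with the marking fact replaced by the three
numerical LEAF facts of its in-tree decomposition (`K3_finrank_complexBetti_two`,
`K3_even_intersectionForm`, `K3_exists_orientation_signature_hodgeRiemann_ample`; the four analytic
inputs of `Huybrechts_K3_marking_exists_holds_of` are theorems). Why the two facts cannot be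
dispensed with by the frame's own hypotheses is recorded in the docstring of
`assembly_of_marking_of_oddBetti`. No new definitions, no named facts introduced.
Prover seat prover-pitem-stmt-HodgeConjecture-13942-c1-0.
-/

noncomputable section

namespace Summit.HodgeConjecture.HodgeConjecture.Theorems.NikulinTwinTransport

open scoped Manifold
open Literature.AlgebraicGeometry.Surfaces
open Literature.AlgebraicGeometry.HodgeTheory (nonempty_hodgeModel_holds
  hodgePQ_independent_of_hodgeModel_holds Voisin2002_closedForm_top_zero_not_exact_holds)
open Literature.NumberTheory.Transcendental (exists_deRhamIsoFamily_holds)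

/-- **The glue `SquareGlue` (`RealMultiplicationSqrtTwoAlgebraic → LefschetzOneOneK3 →
SquareHodgeOfSqrtTwo`) modulo markings of K3 surfaces and `b₁(K3) = b₃(K3) = 0` only**: the
Künneth bookkeeping `squareGlue_of_facts'` of seat 13942-0 with its de Rham and Hodge-model
hypotheses discharged by the tree's theorems `exists_deRhamIsoFamily_holds` and
`nonempty_hodgeModel_holds`. [cite: Varesco2023, §2 (p. 8)] -/
theorem squareGlue_of_marking_of_oddBetti
    (hmark : Huybrechts_K3_marking_exists) (hodd : Huybrechts_K3_oddBetti_vanish) :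
    Theses.NikulinTwinTransport.SquareGlue :=
  squareGlue_of_facts' (fun E _ _ _ => exists_deRhamIsoFamily_holds E) hmark hodd
    fun _ _ => nonempty_hodgeModel_holds

/-- **The frame item `Assembly` modulo markings of K3 surfaces and `b₁(K3) = b₃(K3) = 0` only.**
`assembly_of_facts'` (seat 13942-0: X at the pairs `(S, S)` and Lefschetz `(1,1)` give real
multiplication by `√2` algebraic — `realMultiplicationSqrtTwoAlgebraic_of_marking`, the mirror
trick `e = Ξ − ν̃` with `Ξ = ν ⊕ e` a rational Hodge `2`-self-similitude of `H²(S)`, `ν` a rational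
`2`-similitude of `NS(S)_ℚ` from Witt cancellation against `H²(S, ℚ)(2) ≅ H²(S, ℚ)` — and the
Künneth bookkeeping on `S ⊗ S` gives the sector) with de Rham's theorem and the existence of Hodge
models discharged by `exists_deRhamIsoFamily_holds` and `nonempty_hodgeModel_holds`. Buskin's
theorem and the universal twin (hypotheses two and three of the frame) stay idle.

Why the two remaining facts are not supplied by the frame's own four hypotheses. (1) `b₁ = 0`:
without it the Künneth components of a Hodge class of `S ⊗ S` in `H¹ ⊗ H¹`, `H¹ ⊗ H³`, `H³ ⊗ H³`
are Hodge classes about which X, Buskin, the twin and Lefschetz `(1,1)` for K3 surfaces (all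
statements about `H²`) say nothing. (2) The marking enters only through the similarity class
`H²(S, ℚ)(2) ≅ H²(S, ℚ)` (cf. `realMultiplicationGlue_of_twoSelfSimilar`, seat 13681-2): every
rational Hodge similitude of multiplier `m ∈ {1, 2}` between `H²` of two K3 surfaces restricts to an
`m`-similitude of their Néron–Severi spaces, so if `NS(S)_ℚ(2) ≇ NS(S)_ℚ` then every loop of such
similitudes through twins of `S`, composed and transposed at will, acts on `T(S)` by a RATIONAL
SCALAR (the `T`-parts lie in `ψ·ℚ(e)`, and a loop element `a + b e` is a similitude only if
`ab = 0`, of multiplier `a²` or `2b²`; multiplier `2b²` is excluded on `NS`), while divisor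
correspondences act on `T(S)` by `0` — so `e|_{T(S)}` is not in the span of the correspondences the
four hypotheses make algebraic unless `NS(S)_ℚ ≅ NS(S)_ℚ(2)`, i.e. (Witt, `T ≅ T(2)` via `e`)
unless `H²(S, ℚ) ≅ H²(S, ℚ)(2)`, which in the tree is known only through the K3 lattice
(`k3TwoSelfSimilar_of_marking`, `twoSelfSimilar_of_invariants`).
[cite: Varesco2023, Thm. 2.1, Rem. 2.2 and §2 (p. 8)] [cite: Huybrechts2016K3, Ch. 1 Prop. 3.5, §3.2–3.3] -/
theorem assembly_of_marking_of_oddBetti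
    (hmark : Huybrechts_K3_marking_exists) (hodd : Huybrechts_K3_oddBetti_vanish) :
    Theses.NikulinTwinTransport.Assembly :=
  assembly_of_facts' (fun E _ _ _ => exists_deRhamIsoFamily_holds E) hmark hodd
    fun _ _ => nonempty_hodgeModel_holds

/-- **The frame item `Assembly` modulo `b₁(K3) = b₃(K3) = 0` and the three numerical leaf facts
behind the marking** — `K3_finrank_complexBetti_two` (`b₂ = 22`; Noether's formula),
`K3_even_intersectionForm` (Wu's formula) and `K3_exists_orientation_signature_hodgeRiemann_ample`
(index `−16`, Hodge–Riemann on `H^{2,0}`, an ample class): `assembly_of_marking_of_oddBetti` with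
`Huybrechts_K3_marking_exists` assembled by the librarians' `Huybrechts_K3_marking_exists_holds_of`,
whose analytic inputs are the tree's theorems `Voisin2002_closedForm_top_zero_not_exact_holds`,
`Huybrechts_K3_hodgeTypes_H2_holds`, `hodgePQ_independent_of_hodgeModel_holds` and
`exists_deRhamIsoFamily_holds`. This is the complete list of undischarged named facts the frame
rests on. [cite: Huybrechts2016K3, Ch. 1 Prop. 3.5 and its proof (p. 24); Ch. 1 §3.2–3.3]
[cite: Varesco2023, Thm. 2.1, Rem. 2.2 and §2 (p. 8)] -/
theorem assembly_of_oddBetti_of_k3Invariants (hodd : Huybrechts_K3_oddBetti_vanish)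
    (h22 : K3_finrank_complexBetti_two) (heven : K3_even_intersectionForm)
    (hpos : K3_exists_orientation_signature_hodgeRiemann_ample) :
    Theses.NikulinTwinTransport.Assembly :=
  assembly_of_marking_of_oddBetti
    (Huybrechts_K3_marking_exists_holds_of h22 heven hpos
      (fun E _ _ _ M _ _ => Voisin2002_closedForm_top_zero_not_exact_holds (E := E) (M := M))
      Huybrechts_K3_hodgeTypes_H2_holds hodgePQ_independent_of_hodgeModel_holds
      fun E _ _ _ => exists_deRhamIsoFamily_holds E)
    hodd

end Summit.HodgeConjecture.HodgeConjecture.Theorems.NikulinTwinTransport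

end
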